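import Mathlib
import HarnessLib
import Literature.NumberTheory.GaloisRepresentations.ProjectiveType
import Literature.NumberTheory.GaloisRepresentations.DecomposedGenericOfQuadratic
import Literature.NumberTheory.GaloisRepresentations.ImaginaryQuadraticCyclotomicProofs
import Literature.NumberTheory.GaloisRepresentations.SerreProp16PGL2Cor

/-!
# Stub `stub_enormousResidualPackage` of crux `TensorSquareParallel` (stmt-Langlands-17009), line
# `merged` — helper 3: a scalar `ρ̄(σ)` with `σ ∉ Γ_{F(ζ_p)}` (Qian 2023, Thm. 1.4 (iv))

Crux `stmt-Langlands-17009` = `Summit.Langlands.Langlands.Theses.NonParallelVoid.TensorSquareParallel`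
(line `merged`; stub `stub_enormousResidualPackage` supplies hypotheses (iii)–(iv) of Qian 2023,
Thm. 1.4 for `ρ̄ = ρ.residualRep`, `ρ : Γ_F → GL₂(ℚ̄_p)`, `F` imaginary quadratic, `p ≥ 11`, in the
projectively dihedral corner).  This file PROVES (no named fact) hypothesis (iv), "there exists
`σ ∈ G_F − G_{F(ζ_l)}` such that `r̄(σ)` is a scalar", for any `τ : Γ_F →* GL₂(k)`, `char k = p`,
`[F : ℚ] = 2`, `p ≥ 11`, with `τ|_{Γ_{F(ζ_p)}}` of dihedral type and finite image of order prime to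
`p`:

* §1 `false_of_ker_equiv_dihedral` — group theory: a finite `Q ≤ PGL₂(k)` of order prime to `p`
  admits no homomorphism to a commutative group with kernel `≅ D_m` (`m ≥ 2`) and cyclic image of
  order `≥ 4` — by Serre 1972, Prop. 16 (tree `Serre1972.prop16_card`: `Q` cyclic, dihedral,
  `𝔄₄`, `𝔖₄` or `𝔄₅`), `map_dihedral_sq_eq_one` / `map_perm_sq_eq_one` (homomorphisms from `D_n`,
  `𝔖_n` to commutative groups kill squares), `|𝔄₄| = 12 < 16`, simplicity of `𝔄₅`.
* §2 `Rat.mem_absGaloisGroupAdjoinRootsOfUnity_iff_modNCyclotomicCharacter` (`Γ_{ℚ(ζ_p)} = ker χ_p`),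
  `exists_not_mem_scalar_of_isDihedralType` — the Galois side: `Γ_{F(ζ_p)} = ker(χ_p ∘ res)` with
  cyclic image of order `≥ (p-1)/2 ≥ 5` (`χ_p` onto on `Γ_ℚ`, `[Γ_ℚ : res Γ_F] = 2`); if no
  `σ ∉ Γ_{F(ζ_p)}` had `τ(σ)` scalar, `χ_p ∘ res` would factor through `Proj τ(Γ_F) ≤ PGL₂(k)` with
  kernel `Proj τ(Γ_{F(ζ_p)}) ≅ D_m`, contradicting §1;
  `stub_enormousResidualPackage_scalarElement` — the same as a closed formula (the sub-goal
  registered on the crux item for this file).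

## References

* [Qian2022] L. Qian, *Potential automorphy for `GL_n`*, Invent. Math. 231 (2023), Thm. 1.4 (iv).
* [Serre1972] J.-P. Serre, *Propriétés galoisiennes des points d'ordre fini des courbes
  elliptiques*, Invent. Math. 15 (1972), §2.5, Prop. 16 (through the tree).
* [ACCGHLNSTT2023] P. B. Allen et al., *Potential automorphy over CM fields*, Ann. of Math. 197
  (2023), Rem. 6.1.4 (the role of the scalar element).
-/

set_option linter.dupNamespace false

noncomputable section

namespace Summit.Langlands.Langlands.Theorems.TensorSquareParallel

open scoped MatrixGroups
open Field Literature.NumberTheory.GaloisRepresentations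

/-! ## §1. Group theory: a dihedral group has no cyclic "extension" of order `≥ 4` in `PGL₂(k)` -/
section GroupTheory

/-- A homomorphism from a dihedral group to a commutative group kills all squares (reflections
have order `2` and every rotation is a product of two reflections). [folklore] -/
theorem map_dihedral_sq_eq_one {n : ℕ} {C : Type*} [CommGroup C] (g : DihedralGroup n →* C)
    (x : DihedralGroup n) : g x ^ 2 = 1 := by
  have hsr : ∀ i, g (DihedralGroup.sr i) ^ 2 = 1 := fun i ↦ by
    rw [sq, ← map_mul, DihedralGroup.sr_mul_self, map_one]
  cases x with
  | r i =>
    have e : DihedralGroup.r i = DihedralGroup.sr 0 * DihedralGroup.sr i := by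
      rw [DihedralGroup.sr_mul_sr, sub_zero]
    rw [e, map_mul, mul_pow, hsr, hsr, one_mul]
  | sr i => exact hsr i

/-- A homomorphism from a finite symmetric group to a commutative group kills all squares
(every permutation is a product of transpositions). [folklore] -/
theorem map_perm_sq_eq_one {α : Type*} [DecidableEq α] [Finite α] {C : Type*} [CommGroup C]
    (g : Equiv.Perm α →* C) (x : Equiv.Perm α) : g x ^ 2 = 1 := by
  induction x using Equiv.Perm.swap_induction_on with
  | one => rw [map_one, one_pow]
  | swap_mul f a b hab ih =>
    rw [map_mul, mul_pow, ih, mul_one, sq, ← map_mul, Equiv.swap_mul_self, map_one]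

/-- **No finite subgroup `Q ≤ PGL₂(k)` of order prime to `p = char k` is an extension of a cyclic
group of order `≥ 4` by a dihedral group `D_m`, `m ≥ 2`.**  By Dickson / Serre 1972 Prop. 16
(tree `Serre1972.prop16_card`) `Q` is cyclic (but `D_m ≤ Q` is not), dihedral or `≅ 𝔖₄` (every
homomorphism to a commutative group kills squares, so a cyclic quotient has order `≤ 2`), of
order `12` (but `|Q| = 2m · |Q/D_m| ≥ 16`), or `≅ 𝔄₅` (simple: no normal `D_m`).  This is the
group theory behind "there is `σ ∈ G_F ∖ G_{F(ζ_l)}` with `r̄(σ)` scalar" (ACC+ Rem. 6.1.4 style)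
in the projectively dihedral case. [cite: Serre1972, §2.5, Prop. 16] -/
theorem false_of_ker_equiv_dihedral {k : Type*} [Field k] {p : ℕ} [Fact p.Prime] [CharP k p]
    {Q : Subgroup PGL(Fin 2, k)} {C : Type*} [CommGroup C] (f : Q →* C)
    [Finite f.ker] [Finite f.range] [IsCyclic f.range]
    (hker : ¬ p ∣ Nat.card f.ker) (hran : ¬ p ∣ Nat.card f.range)
    {m : ℕ} (hm : 2 ≤ m) (e : f.ker ≃* DihedralGroup m) (h4 : 4 ≤ Nat.card f.range) : False := by
  have hp : p.Prime := Fact.out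
  have hkercard : Nat.card f.ker = 2 * m := (Nat.card_congr e.toEquiv).trans DihedralGroup.nat_card
  -- `|Q| = |ker f| · |range f|`
  have hmul : Nat.card f.ker * Nat.card f.range = Nat.card Q := by
    rw [← Subgroup.index_ker, Subgroup.card_mul_index]
  have hQ0 : Nat.card Q ≠ 0 := by
    rw [← hmul]; exact mul_ne_zero (by rw [hkercard]; omega) (by omega)
  haveI : Finite Q := Nat.finite_of_card_ne_zero hQ0
  have hQk : ((Nat.card Q : ℕ) : k) ≠ 0 := by
    rw [Ne, CharP.cast_eq_zero_iff k p, ← hmul]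
    intro h
    rcases (Nat.Prime.dvd_mul hp).1 h with h | h
    exacts [hker h, hran h]
  -- if `f` kills all squares then `|range f| ≤ 2`
  have key : (∀ x : Q, f x ^ 2 = 1) → False := fun hall ↦ by
    obtain ⟨g, hg⟩ := IsCyclic.exists_ofOrder_eq_natCard (α := f.range)
    obtain ⟨x, hx⟩ := MonoidHom.mem_range.1 g.2
    have h1 : (g : C) ^ 2 = 1 := by rw [← hx]; exact hall x
    have h2 : orderOf g ≤ 2 := by
      rw [← Subgroup.orderOf_coe]
      exact orderOf_le_of_pow_eq_one (by norm_num) h1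
    omega
  rcases Serre1972.prop16_card Q hQk with hcyc | ⟨n, ⟨eD⟩⟩ | ⟨h12, -⟩ | ⟨-, ⟨eS⟩⟩ | ⟨-, ⟨eA⟩⟩
  · -- cyclic `Q`: then `D_m ≅ ker f` is cyclic
    haveI := hcyc
    exact DihedralGroup.not_isCyclic (n := m) (by omega)
      (isCyclic_of_surjective e.toMonoidHom e.surjective)
  · -- dihedral `Q`
    refine key fun x ↦ ?_
    have := map_dihedral_sq_eq_one (f.comp eD.symm.toMonoidHom) (eD x)
    simpa using this
  · -- `|Q| = 12`
    have : 16 ≤ Nat.card Q := by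
      rw [← hmul, hkercard]
      calc 16 = 2 * 2 * 4 := by norm_num
        _ ≤ 2 * m * Nat.card f.range := Nat.mul_le_mul (Nat.mul_le_mul_left 2 hm) h4
    omega
  · -- `Q ≅ 𝔖₄`
    refine key fun x ↦ ?_
    have := map_perm_sq_eq_one (f.comp eS.symm.toMonoidHom) (eS x)
    simpa using this
  · -- `Q ≅ 𝔄₅` is simple
    haveI : IsSimpleGroup Q := eA.isSimpleGroup
    rcases (MonoidHom.normal_ker f).eq_bot_or_eq_top with h | h
    · rw [h, Subgroup.card_bot] at hkercard; omega
    · have : Nat.card f.range = 1 := by rw [← Subgroup.index_ker, h, Subgroup.index_top]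
      omega

end GroupTheory

/-! ## §2. `Γ_F / Γ_{F(ζ_p)}` is cyclic of order `≥ (p-1)/2`; the scalar element -/
section Galois

variable (p : ℕ) [Fact p.Prime]

/-- **`g ∈ Γ_{ℚ(ζ_p)} ↔ χ_p(g) = 1`** for the mod `p` cyclotomic character `χ_p` of `Γ_ℚ`
(`modNCyclotomicCharacter`): both say that `g` fixes the `p`-th roots of unity of `ℚ̄`.
[folklore] -/
theorem Rat.mem_absGaloisGroupAdjoinRootsOfUnity_iff_modNCyclotomicCharacter [NeZero ((p : ℕ) : ℚ)]
    (g : absoluteGaloisGroup ℚ) :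
    g ∈ absGaloisGroupAdjoinRootsOfUnity ℚ p ↔ modNCyclotomicCharacter ℚ p g = 1 := by
  have hp : p.Prime := Fact.out
  haveI : NeZero p := ⟨hp.ne_zero⟩
  haveI : Fact (1 < p) := ⟨hp.one_lt⟩
  haveI : NeZero ((p : ℕ) : AlgebraicClosure ℚ) := NeZero.charZero
  constructor
  · intro hg
    obtain ⟨ζ, hζ⟩ := HasEnoughRootsOfUnity.exists_primitiveRoot (AlgebraicClosure ℚ) p
    have h1 : g • ζ = ζ ^ (1 : ℕ) := by
      rw [pow_one]; exact (mem_absGaloisGroupAdjoinRootsOfUnity_iff g).1 hg ζ hζ.pow_eq_one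
    have h2 := modNCyclotomicCharacter_eq_of_smul_eq_pow ℚ p hζ g h1
    exact Units.ext (by rw [h2, Nat.cast_one, Units.val_one])
  · intro hg
    rw [mem_absGaloisGroupAdjoinRootsOfUnity_iff]
    intro x hx
    rw [modNCyclotomicCharacter_spec ℚ p g x hx, hg, Units.val_one, ZMod.val_one, pow_one]

variable (F : Type) [Field F] [NumberField F]

/-- **A scalar `τ(σ)` off `Γ_{F(ζ_p)}`** (hypothesis (iv) of Qian 2023, Thm. 1.4, in the
projectively dihedral corner).  Let `[F : ℚ] = 2`, `p ≥ 11`, `k` of characteristic `p`, and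
`τ : Γ_F →* GL₂(k)` with `τ|_{Γ_{F(ζ_p)}}` of dihedral type and finite image of order prime to
`p`.  Then some `σ ∈ Γ_F ∖ Γ_{F(ζ_p)}` has `τ(σ)` scalar.  Proof: `Γ_{F(ζ_p)}` is the kernel of
`ψ = χ_p ∘ res : Γ_F → (ℤ/p)ˣ`, whose image `A` is cyclic of order `≥ (p-1)/2 ≥ 5` (`χ_p` is onto
on `Γ_ℚ`, `Rat.modNCyclotomicCharacter_surjective`, and `[Γ_ℚ : res Γ_F] = 2`).  If no `σ ∉ Γ_{F(ζ_p)}`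
had `τ(σ)` scalar, the kernel of `P = Proj τ` would lie in `ker ψ`, so `ψ` would factor through
`f : P(Γ_F) → (ℤ/p)ˣ` with `ker f = P(Γ_{F(ζ_p)}) ≅ D_m` and `range f = A`, contradicting
`false_of_ker_equiv_dihedral`. [cite: Qian2022, Thm. 1.4 (hypothesis (iv))] -/
theorem exists_not_mem_scalar_of_isDihedralType (hF2 : Module.finrank ℚ F = 2) (hp11 : 11 ≤ p)
    {k : Type} [Field k] [CharP k p] (τ : absoluteGaloisGroup F →* GL (Fin 2) k)
    [Finite (τ.comp (absGaloisGroupAdjoinRootsOfUnity F p).subtype).range]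
    (hcop : ¬ p ∣ Nat.card (τ.comp (absGaloisGroupAdjoinRootsOfUnity F p).subtype).range)
    (hdih : IsDihedralType (τ.comp (absGaloisGroupAdjoinRootsOfUnity F p).subtype)) :
    ∃ σ : absoluteGaloisGroup F, σ ∉ absGaloisGroupAdjoinRootsOfUnity F p ∧
      ∃ c : k, ((τ σ : GL (Fin 2) k) : Matrix (Fin 2) (Fin 2) k) =
        c • (1 : Matrix (Fin 2) (Fin 2) k) := by
  classical
  have hpp : p.Prime := Fact.out
  haveI : NeZero ((p : ℕ) : ℚ) := NeZero.charZero
  haveI : Algebra.IsQuadraticExtension ℚ F := ⟨hF2⟩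
  set Γ₁ := absGaloisGroupAdjoinRootsOfUnity F p with hΓ₁
  -- the character `ψ = χ_p ∘ res`, with kernel `Γ₁`
  set χ := modNCyclotomicCharacter ℚ p with hχ
  set ψ : absoluteGaloisGroup F →* (ZMod p)ˣ := χ.comp (absGaloisRestrict ℚ F).toMonoidHom with hψ
  have hψker : ∀ σ, ψ σ = 1 ↔ σ ∈ Γ₁ := fun σ ↦ by
    rw [hΓ₁, mem_absGaloisGroupAdjoinRootsOfUnity_iff_absGaloisRestrict ℚ F p σ,
      Rat.mem_absGaloisGroupAdjoinRootsOfUnity_iff_modNCyclotomicCharacter]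
    rfl
  -- `|ψ(Γ_F)| ≥ (p - 1)/2 ≥ 5`, prime to `p`
  have hHi : ((absGaloisRestrict ℚ F).range : Subgroup (absoluteGaloisGroup ℚ)).index = 2 :=
    (SorensenPatching.index_range_absGaloisRestrict ℚ F).trans hF2
  have hrange : ψ.range = ((absGaloisRestrict ℚ F).range : Subgroup (absoluteGaloisGroup ℚ)).map χ :=
    MonoidHom.range_comp _ _
  have hidx : ψ.range.index ∣ 2 := by
    rw [hrange, ← hHi]
    exact Subgroup.index_map_dvd _ (Rat.modNCyclotomicCharacter_surjective p)
  have hcardU : Nat.card (ZMod p)ˣ = p - 1 := by rw [Nat.card_eq_fintype_card, ZMod.card_units]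
  have h5 : 5 ≤ Nat.card ψ.range := by
    have h1 := ψ.range.card_mul_index
    rw [hcardU] at h1
    have h2 : ψ.range.index ≤ 2 := Nat.le_of_dvd two_pos hidx
    have h3 : p - 1 ≤ Nat.card ψ.range * 2 := by
      rw [← h1]; exact Nat.mul_le_mul_left _ h2
    omega
  have hranψ : ¬ p ∣ Nat.card ψ.range := fun h ↦ by
    have h1 : Nat.card ψ.range ∣ p - 1 := by
      rw [← hcardU]; exact Subgroup.card_subgroup_dvd_card ψ.range
    have := Nat.le_of_dvd (by omega) (h.trans h1)
    omega
  -- suppose no `σ ∉ Γ₁` has `τ σ` scalar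
  by_contra hcon
  push Not at hcon
  set P : absoluteGaloisGroup F →* PGL(Fin 2, k) := Matrix.ProjGenLinGroup.mk.comp τ with hP
  have hkerP : ∀ σ, P σ = 1 → σ ∈ Γ₁ := by
    intro σ hσ
    by_contra hσ1
    rw [hP, MonoidHom.comp_apply, Matrix.ProjGenLinGroup.mk_eq_one,
      Matrix.GeneralLinearGroup.center_eq_range_scalar] at hσ
    obtain ⟨u, hu⟩ := hσ
    refine hcon σ hσ1 (u : k) ?_
    rw [← hu, Matrix.GeneralLinearGroup.coe_scalar, Matrix.scalar_apply,
      Matrix.smul_one_eq_diagonal]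
  -- `ψ` factors through `P(Γ_F)`: `f ∘ π = ψ`
  set π := P.rangeRestrict with hπ
  have hπsurj : Function.Surjective π := MonoidHom.rangeRestrict_surjective P
  have hle : π.ker ≤ ψ.ker := fun σ hσ ↦ by
    rw [MonoidHom.mem_ker] at hσ ⊢
    rw [hψker]
    exact hkerP σ (congrArg Subtype.val hσ)
  set f : P.range →* (ZMod p)ˣ := π.liftOfSurjective hπsurj ⟨ψ, hle⟩ with hf
  have hfπ : ∀ σ, f (π σ) = ψ σ := fun σ ↦ π.liftOfRightInverse_comp_apply _ _ ⟨ψ, hle⟩ σ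
  have hfran : f.range = ψ.range := by
    ext y
    constructor
    · rintro ⟨x, rfl⟩
      obtain ⟨σ, rfl⟩ := hπsurj x
      exact ⟨σ, (hfπ σ).symm⟩
    · rintro ⟨σ, rfl⟩
      exact ⟨π σ, hfπ σ⟩
  -- `ker f ≅ P(Γ₁) = Proj τ(Γ₁) ≅ D_m`
  obtain ⟨m, hm, ⟨eD⟩⟩ := hdih
  have hkermap : f.ker.map P.range.subtype = projectiveImage (τ.comp Γ₁.subtype) := by
    ext x
    constructor
    · rintro ⟨y, hy, rfl⟩
      obtain ⟨σ, rfl⟩ := hπsurj y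
      rw [SetLike.mem_coe, MonoidHom.mem_ker, hfπ, hψker] at hy
      exact ⟨⟨σ, hy⟩, rfl⟩
    · rintro ⟨σ, rfl⟩
      refine ⟨π σ, ?_, rfl⟩
      rw [SetLike.mem_coe, MonoidHom.mem_ker, hfπ, hψker]
      exact σ.2
  let e₁ : f.ker ≃* projectiveImage (τ.comp Γ₁.subtype) :=
    (f.ker.equivMapOfInjective P.range.subtype P.range.subtype_injective).trans
      (MulEquiv.subgroupCongr hkermap)
  haveI : Finite (projectiveImage (τ.comp Γ₁.subtype)) := finite_projectiveImage_of_finite_range _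
  haveI : Finite f.ker := Finite.of_equiv _ e₁.symm.toEquiv
  have hkercop : ¬ p ∣ Nat.card f.ker := by
    rw [Nat.card_congr e₁.toEquiv]
    exact fun h ↦ hcop
      (h.trans (Subgroup.card_dvd_of_surjective _ (rangeToProjectiveImage_surjective _)))
  haveI : Finite f.range := by rw [hfran]; infer_instance
  haveI : IsCyclic f.range := by rw [hfran]; infer_instance
  have h4 : 4 ≤ Nat.card f.range := by rw [hfran]; omega
  have hrancop : ¬ p ∣ Nat.card f.range := by rw [hfran]; exact hranψ
  exact false_of_ker_equiv_dihedral f hkercop hrancop hm (e₁.trans eD) h4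

/-- **Registered sub-goal `stub_enormousResidualPackage_scalarElement` of stub
`stub_enormousResidualPackage`** (crux stmt-Langlands-17009, line `merged`): the statement of
`exists_not_mem_scalar_of_isDihedralType` as a closed formula.
[cite: Qian2022, Thm. 1.4 (hypothesis (iv))] -/
theorem stub_enormousResidualPackage_scalarElement : ∀ (F : Type) [Field F] [NumberField F], Module.finrank ℚ F = 2 → ∀ (p : ℕ) [Fact p.Prime], 11 ≤ p → ∀ (k : Type) [Field k] [CharP k p] (τ : absoluteGaloisGroup F →* GL (Fin 2) k), Finite (τ.comp (absGaloisGroupAdjoinRootsOfUnity F p).subtype).range → ¬ p ∣ Nat.card (τ.comp (absGaloisGroupAdjoinRootsOfUnity F p).subtype).range → IsDihedralType (τ.comp (absGaloisGroupAdjoinRootsOfUnity F p).subtype) → ∃ σ : absoluteGaloisGroup F, σ ∉ absGaloisGroupAdjoinRootsOfUnity F p ∧ ∃ c : k, ((τ σ : GL (Fin 2) k) : Matrix (Fin 2) (Fin 2) k) = c • (1 : Matrix (Fin 2) (Fin 2) k) := by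
  intro F _ _ hF2 p _ hp11 k _ _ τ hfin hcop hdih
  exact exists_not_mem_scalar_of_isDihedralType p F hF2 hp11 τ hcop hdih

end Galois

end Summit.Langlands.Langlands.Theorems.TensorSquareParallel

end
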